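import Summits.BirchSwinnertonDyer.BirchSwinnertonDyer.Theorems.CongruentShaFreeCutOfHeegnerNonTorsion
import Summits.BirchSwinnertonDyer.Rank1Residual.Partition.AnticyclotomicControlPublishedPlaces
import Summits.BirchSwinnertonDyer.Rank1Residual.Partition.MainConjecturesAnticyclotomicGood
import Literature.NumberTheory.EllipticCurves.AnticyclotomicPConverseLinks

set_option linter.dupNamespace false
set_option autoImplicit false

/-! # Route `CongruentShaFreeCut` (rung S2) — crux `AnalyticRankOneOfRankOneFiniteShaTwo`
(stmt-BirchSwinnertonDyer-19080): the research stub `HeegnerNonTorsionAtTwo` SPLIT into its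
algebraic link (anticyclotomic control at the additive prime `2`) and its analytic link (main
conjecture ∘ `2`-adic Waldspurger/BDP formula at the trivial character), EVERY SYMBOL A TREE OBJECT

Cell `bsd-cn100`, typer seat `bsd-cn100-ty` g2 — the "split with teeth" asked for by the plan seat
(HOME/HANDOFF.md § plan g9: "content strictly below B first appears when the research stub is SPLIT
into (MC side) corank 1 ⟹ 𝓛₂(𝟙) ≠ 0 and (ERL side) 𝓛₂(𝟙) = unit·log_ω(y_K)² over a TYPED `2`-adic
object") and designed by the prover seat `bsd-cn100-s2-c3` (HOME/bsd-cn100-s2-c3/T3-MEMO-crux-B-two-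
leaves.md §2). Supports, does not close, stmt-BirchSwinnertonDyer-19080. HONEST FRAMING: nothing
here proves crux B, the leaf `rankOne_twoConverse_congruentNumber` or any case of BSD; two OPEN
statements are NAMED (`@[conjecture] def`, nothing asserted) and their composition to the landed
stub is PROVED.

## The typed `2`-adic object (no posited `L`-function, no `∃`-junk)

The s2-c3 memo posits a structure `TwoAdicBDPData` carrying a `2`-adic `L`-function `L : UnrSeries 2`
with an interpolation field `interp : IsBDPLFunction …`, and itself records the obstruction: at a
prime `p ∣ N` the printed BDP interpolation formula degenerates (`bdpInterpolationValue_of_dvd`), so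
at the ADDITIVE prime `2` of `E_n : y² = x³ − n²x` (`N(E_n) = 32n²` or `16n²`) the interpolation
property is itself research content (Fan–Wan arXiv:2304.09806v2 Prop. 3.6 [Int], typed by this seat
as `FanWan2023.IsNonsplitRubinLFunction` over `ℚ(i)`; Kříž). A `∀ d : TwoAdicBDPData`-leaf over a
non-pinning `interp` is junk-false, an `∃`-leaf junk-true (plan g5/g6 dead ends). This file therefore
uses the device by which the tree ALREADY types the analogous links at a good prime without any
`L`-function object — Castella–Grossi–Lee–Skinner 2022 as vendored in
`CastellaGrossiLeeSkinner2022/AnticyclotomicControl.lean` (Thm. 5.1.1, `thm511_anticyclotomicControl`)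
and `…/BDPValueAtTrivialCharacter.lean` (display (5.4) ∘ Thm. 5.1.3,
`display54_thm513_generator_constantCoeff`): the anticyclotomic main conjecture is EVALUATED AT THE
TRIVIAL CHARACTER and COMPOSED with the BDP formula (generic half, curve- and prime-independent:
`Literature/NumberTheory/EllipticCurves/AnticyclotomicPConverseLinks.lean`, predicate
`AcPConverseLinks.CharValueEqLogSqAt` and the PROVED step `AcPConverseLinks.not_isOfFinAddOrder_of_links`),
so that the only analytic object left is

* `𝔛 = AcSelmer.XAc ((E_n)_K) 2 κ v̄ ∅ γ` — the Pontryagin dual of the `2^∞`-Selmer group of `E_n`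
  over the anticyclotomic `ℤ₂`-extension `K_∞/K` with the Greenberg/BDP local conditions RELAXED at
  `v` and STRICT at `v̄` (`2 = v v̄` split in the auxiliary `K`; Castella 2018 Def. 2.2, CGLS §1.4
  `𝔛_E`; Literature object `Castella2018/AnticyclotomicSelmerDual.lean`). These local conditions do
  not refer to the reduction type, so the module is meaningful at the additive prime `2`;
* a generator `F ∈ Λ = ℤ₂⟦T⟧` of its characteristic ideal and its value `F(0) ∈ ℤ₂` at the trivial
  character (`AcSelmer.XAc.charIdeal`, `PowerSeries.constantCoeff`);
* the `2`-adic formal-group logarithm of the Heegner point read in `E_n(K_v) = E_n(ℚ₂)` along the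
  embedding `ι` inducing `v` (`padicPointOf`, `formalIndex`, `padicLogPoint`, `PadicFormalLogOrder.lean`).

## The two links (both OPEN at `p = 2` for `E_n`; refereed templates named in the docstrings)

* `TwoAdicControlOfRankOne` (algebraic; CGLS Thm. 5.1.1 / Jetchev–Skinner–Wan Thm. 3.3.1 / Castella
  2018 Thm. 2.3 shape): `rank E_n(K) = 1 ∧ #Ш(E_n/K)[2^∞] < ∞ ⟹ 𝔛` is `Λ`-torsion and `F(0) ≠ 0`,
  stated in the tree's currency `∃ m, AcSelmer.XAc.HasCharValuationAt … m` (reused, not restated).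
  What is NOT carried from the template: CGLS's hypothesis `E(ℚ_p)[p] = 0` FAILS here (`E_n[2] ⊂
  E_n(ℚ)`), and no valuation formula for `F(0)` is claimed — only non-vanishing (the currency of a
  `p`-converse; the valuation currency `AcSelmer.XAc.HasCharValuationAt` of the `p`-part files is not
  needed and `padicLogOrd` has junk value at `log = 0`).
* `TwoAdicCharValueEqHeegnerLogSq` (analytic; CGLS Thm. 4.2.2 at `𝟙` ∘ Thm. 5.1.3 = display (5.4)
  shape; BDP 2013 Thm. 5.13; Castella 2018 Thm. 3.2): under (Sel) `corank_{ℤ₂} Sel_{2^∞}(E_n/K) = 1`,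
  `𝔛` is `Λ`-torsion and `F(0) = u · log_{ω}(P_K)²` for a NON-ZERO `u ∈ ℚ₂`, `P_K` any Heegner point
  of level `N(E_n)` — the Literature predicate `AcPConverseLinks.CharValueEqLogSqAt (E_n) 2 κ v̄ γ ι P`.
  `-- TODO(constant):` in print (good `p`) `u ∈ ℤ_p^× · c_E⁻² (1 − a_p p⁻¹ + p⁻¹)²`;
  at the additive prime `2` no constant is printed, so only `u ≠ 0` is stated (the part a
  `p`-converse consumes). This link is where a `2`-adic `L`-function lives INSIDE THE PROOF (main
  conjecture `char 𝔛 · Λ^ur = (𝓛₂)` and `𝓛₂(𝟙) = … log²`): Fan–Wan v2 Thm. 5.18 [RMCC] and Thm.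
  4.2/4.4 [ERC] over `ℚ(i)` (unrefereed; `FanWan2023/NonsplitPConverseClaims.lean`), Kříž v5 §§9–10.

## The glue (PROVED, `heegnerNonTorsionAtTwo_of_twoAdicLinks`)

Given the data of `HeegnerNonTorsionAtTwo` (square-free `n`; `K` imaginary quadratic with the Heegner
hypothesis for `N = N(E_n)` and for `2`; `L(E_n^{(d_K)}, 1) ≠ 0`; `rank E_n(ℚ) = 1`; `#Ш(E_n/ℚ)[2^∞]
< ∞`; a Heegner point `P`): Kato (`hKato`, binder as in the landed helpers) makes the twist
`E_n^{(d_K)}` of rank `0` with finite `Ш[2^∞]`, so `rank E_n(K) = 1`, `corank_{ℤ₂} Sel_{2^∞}(E_n/K) =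
1` and `#Ш(E_n/K)[2^∞] < ∞` (`AcPConverseLinks.rank_corank_sha_baseChange_of_twist_L_one_ne_zero`);
the anticyclotomic datum `(κ, γ, 𝔭, ι = embAt, v, v̄)` EXISTS
(`X11b.exists_anticyclotomic_generator_degreeOnePrime`, `X11b.inducedPlace`, `X11b.exists_other_prime`
— the non-vacuity lemmas of the b2b cell's CGLS adapter `Partition/MainConjecturesEisensteinBDP.lean`);
at that datum the two links feed `AcPConverseLinks.not_isOfFinAddOrder_of_links` (generators of one
principal ideal differ by a unit, so `F_B(0) ≠ 0`, so `log_ω(m₀ • P_ι) ≠ 0`, which fails for a torsion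
`P`: Silverman AEC IV.6.4 / VII.2.2 — elementary, no height, no regulator: the barrier
`PAdicHeightNondegeneracy` is not met). With the landed
`CongruentShaFreeCutOfHeegnerNonTorsion.analyticRankOne_of_facts_of_heegnerNonTorsion` this yields
crux B from the two links and eight refereed facts (`cruxB_of_twoAdicLinks`).

PLACEMENT (print, for the tribunal's T3/T5): both links are THEOREMS in print at a good ordinary
`p > 2` (CGLS 2022 Thm. 5.1.1; CGLS Thm. 4.2.2 + Thm. 5.1.3 at Eisenstein `p`; Burungale–Castella–
Skinner 2025 Thm. 1.2.4 / BDP 2013 at `p ∤ N` irreducible), at `p ∥ N` multiplicative (Castella 2018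
Thm. 2.3 / 3.2), and for CM curves at good ordinary `p` (Burungale–Tian 2020 via Rubin's two-variable
main conjecture); NEITHER is in print at a prime of additive reduction, and for `E_n` the prime `2` is
additive for every `n`. The links are strictly weaker than crux B separately (the first says nothing
about `L`-values or Heegner points, the second nothing about `E_n(ℚ)`), and jointly imply it.

References: [CastellaGrossiLeeSkinner2022] Thm. 4.2.2, Thm. 5.1.1, Thm. 5.1.3, (5.4); [Castella2018]
Def. 2.2, Thm. 2.3, Thm. 3.2; [JetchevSkinnerWan2017] Thm. 3.3.1; [BertoliniDarmonPrasanna2013]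
Thm. 5.13; [FanWan2023] Thm. 4.2/4.4, 5.18, 6.9 (claims); [SilvermanAEC2009] IV.6.4, VII.2.2. -/

noncomputable section

open scoped Classical

namespace Summit.BirchSwinnertonDyer.BirchSwinnertonDyer.Theorems.CongruentShaFreeCutTwoAdicLinks

open WeierstrassCurve NumberField IsDedekindDomain Field Literature.NumberTheory.EllipticCurves
  Literature.NumberTheory.EllipticCurves.Castella2018
open Summit.BirchSwinnertonDyer.BirchSwinnertonDyer.Theses.CongruentShaFreeCut
open Summit.BirchSwinnertonDyer.BirchSwinnertonDyer.Theorems.CongruentShaFreeCutOfHeegnerNonTorsion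
  (HeegnerNonTorsionAtTwo analyticRankOne_of_facts_of_heegnerNonTorsion)

/-! ## 1. The two links (OPEN; named, nothing asserted) -/

/-- **Link A (algebraic) — anticyclotomic control for `E_n` at the ADDITIVE prime `2`, in the
non-vanishing currency.** For square-free `n`, an imaginary quadratic `K` with the Heegner hypothesis
for `N = N(E_n)` and with `2 = v v̄` split, an embedding `ι : K ↪ ℚ₂` inducing `v`, the anticyclotomic
`ℤ₂`-extension `κ` of `K` with topological generator `γ`: if `rank_ℤ E_n(K) = 1` and `#Ш(E_n/K)[2^∞] <
∞`, then the dual Selmer group `𝔛 = X_ac(E_n[2^∞])` over `K_∞` (relaxed at `v`, strict at `v̄`;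
`AcSelmer.XAc`) is `Λ`-torsion and a generator `F` of its characteristic ideal has `F(0) ≠ 0` — in
the tree's currency: `AcSelmer.XAc.HasCharValuationAt … m` for SOME `m` (= `ord₂ F(0)`, not
prescribed). SHAPE of Castella–Grossi–Lee–Skinner 2022 Thm. 5.1.1 (`thm511_anticyclotomicControl`, good
ordinary `p > 2`, which moreover gives `m` exactly and assumes `E(ℚ_p)[p] = 0` — false for `E_n` at
`2`) and of
Jetchev–Skinner–Wan 2017 Thm. 3.3.1 / Castella 2018 Thm. 2.3; OPEN at the additive prime `2`
(Fan–Wan v2 §5 "± local conditions at ramified `2`" addresses the `ℚ(i)`-analogue, unrefereed).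
Research-grade; nothing asserted; strictly weaker than crux B (no `L`-value, no Heegner point).
[cite: CastellaGrossiLeeSkinner2022, Thm. 5.1.1 (shape only; nothing asserted)]
[cite: JetchevSkinnerWan2017, Thm. 3.3.1 (shape only; nothing asserted)]
[cite: Castella2018, Def. 2.2 and Thm. 2.3 (arXiv:1704.06608 p. 5) (shape only; nothing asserted)] -/
@[conjecture] def TwoAdicControlOfRankOne : Prop :=
  ∀ ⦃n : ℕ⦄, Squarefree n → ∀ (K : Type) [Field K] [NumberField K] (N : ℕ) [NeZero N],
    (congruentNumberCurve n).conductorNorm ℤ = N → IsImaginaryQuadratic K →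
      SatisfiesHeegnerHypothesis N K → SatisfiesHeegnerHypothesis 2 K →
    ∀ (ι : K →+* ℚ_[2]) (v vbar : HeightOneSpectrum (𝓞 K)),
      (∀ x : 𝓞 K, x ∈ v.asIdeal ↔ ‖ι (x : K)‖ < 1) →
      ((2 : ℕ) : 𝓞 K) ∈ vbar.asIdeal → vbar ≠ v →
    ∀ (κ : ZpExtension K 2), κ.IsAnticyclotomic →
    ∀ (γ : absoluteGaloisGroup K) [Fact (κ.IsTopGenerator γ)],
      ((congruentNumberCurve n).baseChange K).mordellWeilRank = 1 →
      Finite (AddCommGroup.primaryComponent ((congruentNumberCurve n).baseChange K).sha 2) →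
      ∃ m : ℕ, AcSelmer.XAc.HasCharValuationAt ((congruentNumberCurve n).baseChange K) 2 κ vbar ∅ γ m

/-- **Link B (analytic) — the `2`-adic anticyclotomic main conjecture for `E_n` evaluated at the
trivial character, composed with the `2`-adic Waldspurger/BDP formula: `F(0) = u · log_ω(P_K)²`,
`u ≠ 0`.** For square-free `n`, `K`, `N = N(E_n)`, `ι`, `v`, `v̄`, `κ`, `γ` as in Link A, under (Sel)
`corank_{ℤ₂} Sel_{2^∞}(E_n/K) = 1`, and for every Heegner point `P ∈ E_n(K)` of level `N`
(`IsHeegnerPoint`): `𝔛` is `Λ`-torsion and a generator `F` of `char_Λ 𝔛` satisfies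
`F(0) = u · (log_W(z(m₀ • P_ι))/m₀)²` for some NON-ZERO `u ∈ ℚ₂`, where `P_ι ∈ E_n(ℚ₂)` is `P` read
along `ι` (`padicPointOf`), `m₀ = [E_n(ℚ₂) : E_{n,1}(ℚ₂)]` (`formalIndex`, on the globally minimal
model `y² = x³ − n²x`) and `log_W ∘ z` the formal-group logarithm (`padicLogPoint`) — the Literature
predicate `AcPConverseLinks.CharValueEqLogSqAt` at `(E_n, 2, κ, v̄, γ, ι, P)`. SHAPE of CGLS
2022 display (5.4) ∘ Thm. 5.1.3 (`display54_thm513_generator_constantCoeff`: there, at a good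
Eisenstein `p > 2`, `u ∈ ℤ_p^× · c_E⁻²(1 − a_p p⁻¹ + p⁻¹)²` with `c_E` the Manin constant), of BDP 2013
Thm. 5.13 and Castella 2018 Thm. 3.2 ("up to a `p`-adic unit `L_p(f,𝟙) = (1 − a_p p⁻¹ + ε_p)² ·
(log_{ω_E} P_K)²`"); the `2`-adic `L`-function of the printed proofs (`char 𝔛 · Λ^ur = (𝓛)`,
`𝓛(𝟙) = … log²`) is eliminated by the composition. OPEN at the additive prime `2`: Fan–Wan v2 Thm.
5.18 [RMCC] with Thm. 4.2/4.4 [ERC] over `ℚ(i)` (unrefereed claims,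
`FanWan2023.thm69_analyticRank_eq_one_of_selmerCorank_eq_one_of_not_cmSplit_CLAIMED`), Kříž v5
§§9–10. Research-grade; nothing asserted; strictly weaker than crux B (nothing about `E_n(ℚ)`).
-- TODO(constant): the printed good-reduction constant; at additive `2` none is in print, only `u ≠ 0`.
[cite: CastellaGrossiLeeSkinner2022, Thm. 4.2.2, Thm. 5.1.3 and display (5.4) (shape only; nothing asserted)]
[cite: BertoliniDarmonPrasanna2013, Thm. 5.13 (shape only; nothing asserted)]
[cite: Castella2018, Thm. 3.2 (arXiv:1704.06608 p. 9) (shape only; nothing asserted)] -/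
@[conjecture] def TwoAdicCharValueEqHeegnerLogSq : Prop :=
  ∀ ⦃n : ℕ⦄, Squarefree n →
    ∀ [(congruentNumberCurve n).IsElliptic] [(congruentNumberCurve n).IsGloballyMinimal]
      (K : Type) [Field K] [NumberField K] (N : ℕ) [NeZero N],
    (congruentNumberCurve n).conductorNorm ℤ = N → IsImaginaryQuadratic K →
      SatisfiesHeegnerHypothesis N K → SatisfiesHeegnerHypothesis 2 K →
    ∀ (ι : K →+* ℚ_[2]) (v vbar : HeightOneSpectrum (𝓞 K)),
      (∀ x : 𝓞 K, x ∈ v.asIdeal ↔ ‖ι (x : K)‖ < 1) →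
      ((2 : ℕ) : 𝓞 K) ∈ vbar.asIdeal → vbar ≠ v →
    ∀ (κ : ZpExtension K 2), κ.IsAnticyclotomic →
    ∀ (γ : absoluteGaloisGroup K) [Fact (κ.IsTopGenerator γ)],
      ((congruentNumberCurve n).baseChange K).selmerCorank 2 = 1 →
    ∀ (P : ((congruentNumberCurve n).baseChange K).toAffine.Point),
      IsHeegnerPoint N (congruentNumberCurve n) K P →
        AcPConverseLinks.CharValueEqLogSqAt (congruentNumberCurve n) 2 κ vbar γ ι P

/-! ## 2. The composition: the two links imply `HeegnerNonTorsionAtTwo`, hence crux B (PROVED) -/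

/-- **`HeegnerNonTorsionAtTwo` from the two `2`-adic links** (granted Kato's finiteness theorem for
the twist, `hKato`, the binder of the landed helpers). Proof (module docstring §Glue): descend the
rank-one data to `K`; produce the anticyclotomic datum `(κ, γ)`, a degree-one `𝔭 ∋ 2`, THE
embedding `ι = embAt K 2 𝔭`, `v = inducedPlace ι`, `v̄ ≠ v`; Link A gives a generator with
`F_A(0) ≠ 0`, Link B a generator with `F_B(0) = u · log²`, `u ≠ 0`; generators of one principal ideal
of `Λ` differ by a unit, so `F_B(0) ≠ 0`, so `log_W(z(m₀ • P_ι)) ≠ 0`, so `P` is not torsion.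
[cite: CastellaGrossiLeeSkinner2022, §5.2 (proof of Thm. 5.2.1: the shape of a BDP-type p-converse)]
[cite: SilvermanAEC2009, IV.6.4 and VII.2.2] -/
theorem heegnerNonTorsionAtTwo_of_twoAdicLinks
    (hKato : ∀ (W : WeierstrassCurve ℚ) [W.IsElliptic] (p : ℕ) [Fact p.Prime],
      kato_finite_of_L_one_ne_zero W p)
    (hA : TwoAdicControlOfRankOne) (hB : TwoAdicCharValueEqHeegnerLogSq) :
    HeegnerNonTorsionAtTwo := by
  intro n hsq K _ _ N _ hN hK hHN hH2 hL hrank hsha P hP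
  haveI := isElliptic_congruentNumberCurve hsq.ne_zero
  haveI := isGloballyMinimal_congruentNumberCurve hsq
  -- the rank-one data over `K`
  obtain ⟨hrk, hcork, hshaK⟩ := AcPConverseLinks.rank_corank_sha_baseChange_of_twist_L_one_ne_zero
    hKato (congruentNumberCurve n) 2 hK hL hrank hsha
  -- the anticyclotomic datum
  obtain ⟨κ, γ, 𝔭, hκ, hγ, h𝔭, he, hf⟩ :=
    Summit.BirchSwinnertonDyer.Rank1Residual.X11b.exists_anticyclotomic_generator_degreeOnePrime
      2 K hK hH2
  haveI : Fact (κ.IsTopGenerator γ) := ⟨hγ⟩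
  let ι : K →+* ℚ_[2] := Summit.BirchSwinnertonDyer.Rank1Residual.X11b.embAt K 2 𝔭 h𝔭 he hf
  obtain ⟨vbar, hvbar, hne⟩ :=
    Summit.BirchSwinnertonDyer.Rank1Residual.X11b.exists_other_prime hH2
      (Summit.BirchSwinnertonDyer.Rank1Residual.X11b.inducedPlace ι)
      (Summit.BirchSwinnertonDyer.Rank1Residual.X11b.natCast_mem_inducedPlace ι)
  have hv := Summit.BirchSwinnertonDyer.Rank1Residual.X11b.mem_inducedPlace_iff ι
  -- step (4): the two links at this datum force `P` to be non-torsion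
  exact AcPConverseLinks.not_isOfFinAddOrder_of_links (congruentNumberCurve n) 2 κ vbar γ ι P
    (hA hsq K N hN hK hHN hH2 ι (Summit.BirchSwinnertonDyer.Rank1Residual.X11b.inducedPlace ι) vbar
      hv hvbar hne κ hκ γ hrk hshaK)
    (hB hsq K N hN hK hHN hH2 ι (Summit.BirchSwinnertonDyer.Rank1Residual.X11b.inducedPlace ι) vbar
      hv hvbar hne κ hκ γ hcork P hP)

/-- **Crux B from the two `2`-adic links and eight refereed facts**: `2`-parity (`hpar`), Modularity
(`hmod`), Hoffstein–Luo (`hHL`), Kato (`hKato`), existence of Heegner points (`hHP`, Gross 1984),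
Gross–Zagier + Kolyvagin (`hGZ`), and the two links (`hA`, `hB`) give
`AnalyticRankOneOfRankOneFiniteShaTwo` — by `heegnerNonTorsionAtTwo_of_twoAdicLinks` and the landed
`CongruentShaFreeCutOfHeegnerNonTorsion.analyticRankOne_of_facts_of_heegnerNonTorsion`. CONDITIONAL on
the two open links; credits nothing. [cite: GrossZagier1986, Thm. I.6.3 with V.§2]
[cite: CastellaGrossiLeeSkinner2022, §5.2 (proof of Thm. 5.2.1)] -/
theorem cruxB_of_twoAdicLinks
    (hpar : ∀ (W : WeierstrassCurve ℚ) [W.IsElliptic] (p : ℕ) [Fact p.Prime], p_parity W p)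
    (hmod : ModularForms.exists_isNewformOf) (hHL : HoffsteinLuo1997_exists_twist_L_one_ne_zero)
    (hKato : ∀ (W : WeierstrassCurve ℚ) [W.IsElliptic] (p : ℕ) [Fact p.Prime],
      kato_finite_of_L_one_ne_zero W p)
    (hHP : ∀ (W : WeierstrassCurve ℚ) (K : Type) [Field K] [NumberField K],
      exists_isHeegnerPoint W K)
    (hGZ : ∀ (W : WeierstrassCurve ℚ) (N : ℕ) [NeZero N] (K : Type) [Field K] [NumberField K],
      analyticRankEK_eq_one_iff_heegner_nonTorsion W N K)
    (hA : TwoAdicControlOfRankOne) (hB : TwoAdicCharValueEqHeegnerLogSq) :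
    Summit.BirchSwinnertonDyer.BirchSwinnertonDyer.Theses.CongruentShaFreeCut.AnalyticRankOneOfRankOneFiniteShaTwo :=
  analyticRankOne_of_facts_of_heegnerNonTorsion hpar hmod hHL hKato hHP hGZ
    (heegnerNonTorsionAtTwo_of_twoAdicLinks hKato hA hB)

end Summit.BirchSwinnertonDyer.BirchSwinnertonDyer.Theorems.CongruentShaFreeCutTwoAdicLinks

end
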